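import Summits.FinalStateConjecture.FinalStateConjecture.Theorems.ClusterCompletenessOmegaLimitMultiKerrDefs
import HarnessLib

/-!
# Crux `ClusterCompleteness.OmegaLimitMultiKerr` (stmt-FinalStateConjecture-14664), line `Sketch` —
# the sequential (diagonal) form of the recurrence clause of `Recurs k 𝒟`

Structure stub (not a composition stub) of the line lead (gen 3) for the crux `OmegaLimitMultiKerr`
("for every order `k`, Christodoulou-generically an MGHD exists and every MGHD that does NOT settle
down RECURS at order `k`"), over the landed vocabulary `Recurs k` of
`ClusterCompletenessOmegaLimitMultiKerrDefs`.

`Recurs k 𝒟` packages anchored final-state-shaped late charts in which `Cᵏ` `ε`-closeness to ONE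
multi-Kerr configuration recurs: its last clause reads
`∀ R', ∀ ε > 0, ∃ᶠ τ in atTop, deviationCk … Ψ₀ k τ ≤ ε ∧ ∀ i, truncDeviationCk … (Ψ i) k R' τ ≤ ε`.
Every compactness / ω-limit argument for the crux PRODUCES instead a sequence of chart times
`Tₙ → ∞` along which all these deviations tend to `0` (for every near-zone radius `R'`). This file is
the once-and-for-all equivalence of the two forms:

* `frequently_le_iff_exists_seq_tendsto` — the abstract lemma: for `f : ℝ → [0, ∞]` and finitely
  many `gᵢ : ℝ → ℝ → [0, ∞]` monotone in the radius variable, "`∀ R' ∀ ε > 0 ∃ᶠ τ, f τ ≤ ε ∧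
  ∀ i, gᵢ R' τ ≤ ε`" iff "`∃ Tₙ → ∞, f (Tₙ) → 0 ∧ ∀ i R', gᵢ R' (Tₙ) → 0`" (the diagonal in `R'`
  is where monotonicity is used);
* `recurs_iff_exists_seq` — `Recurs k 𝒟` with its last clause replaced by the sequential form,
  clauses 1–10 unchanged (monotonicity in the radius is `Spacetime.truncDeviationCk_mono`).

Everything is proved; Mathlib + the landed `Theorems` files only.
-/

-- every `Summit.FinalStateConjecture.FinalStateConjecture.…` name repeats the summit = sub-problem segment (D-0017 layout)
set_option linter.dupNamespace false

noncomputable section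

open scoped Manifold ContDiff Topology ENNReal
open Set Filter TopologicalSpace

namespace Summit.FinalStateConjecture.FinalStateConjecture.Theorems.ClusterCompleteness

open Literature.Geometry.Lorentzian

/-! ### The abstract lemma: recurrence for every `ε` and every radius is sequential convergence -/

/-- **Frequent smallness at every radius is convergence along a sequence of times.** For
`f : ℝ → [0, ∞]` and finitely many `gᵢ : ℝ → ℝ → [0, ∞]` with `R ↦ gᵢ R τ` monotone, the following
are equivalent: (a) for every radius `R'` and every `ε > 0`, frequently as `τ → ∞` both `f τ ≤ ε`
and `gᵢ R' τ ≤ ε` for all `i`; (b) there is a sequence of times `Tₙ → ∞` with `f (Tₙ) → 0` and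
`gᵢ R' (Tₙ) → 0` for every `i` and every `R'`. For (a) ⇒ (b) pick `Tₘ ≥ m` with `f (Tₘ) ≤ 1/(m+1)`
and `gᵢ m (Tₘ) ≤ 1/(m+1)` (radius `m`, the diagonal) and use monotonicity in the radius for
`m ≥ R'`; (b) ⇒ (a) is "eventually along `Tₙ`" pushed forward to "frequently in `τ`". [folklore] -/
theorem frequently_le_iff_exists_seq_tendsto {ι : Type*} [Finite ι] {f : ℝ → ℝ≥0∞}
    {g : ι → ℝ → ℝ → ℝ≥0∞} (hg : ∀ i τ, Monotone fun R ↦ g i R τ) :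
    (∀ R' : ℝ, ∀ ε : ℝ, 0 < ε → ∃ᶠ τ in atTop,
        f τ ≤ ENNReal.ofReal ε ∧ ∀ i, g i R' τ ≤ ENNReal.ofReal ε) ↔
      ∃ T : ℕ → ℝ, Tendsto T atTop atTop ∧ Tendsto (fun n ↦ f (T n)) atTop (𝓝 0) ∧
        ∀ i (R' : ℝ), Tendsto (fun n ↦ g i R' (T n)) atTop (𝓝 0) := by
  refine ⟨fun h ↦ ?_, fun ⟨T, hT, hf, hgT⟩ R' ε hε ↦ ?_⟩
  · -- the diagonal: radius `m`, tolerance `1 / (m + 1)`, a time `T m ≥ m`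
    have hm : ∀ m : ℕ, ∃ T : ℝ, (m : ℝ) ≤ T ∧ f T ≤ ENNReal.ofReal (1 / ((m : ℝ) + 1)) ∧
        ∀ i, g i m T ≤ ENNReal.ofReal (1 / ((m : ℝ) + 1)) := fun m ↦
      frequently_atTop.1 (h m _ Nat.one_div_pos_of_nat) m
    choose T hTm hfT hgT using hm
    have h0 : Tendsto (fun m : ℕ ↦ ENNReal.ofReal (1 / ((m : ℝ) + 1))) atTop (𝓝 0) := by
      simpa only [ENNReal.ofReal_zero] using
        ENNReal.tendsto_ofReal tendsto_one_div_add_atTop_nhds_zero_nat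
    refine ⟨T, tendsto_atTop_mono hTm tendsto_natCast_atTop_atTop,
      tendsto_of_tendsto_of_tendsto_of_le_of_le tendsto_const_nhds h0 (fun _ ↦ zero_le) hfT,
      fun i R' ↦ tendsto_of_tendsto_of_tendsto_of_le_of_le' tendsto_const_nhds h0
        (Eventually.of_forall fun _ ↦ zero_le) ?_⟩
    filter_upwards [eventually_ge_atTop ⌈R'⌉₊] with m hm
    exact (hg i (T m) ((Nat.le_ceil R').trans (Nat.cast_le.mpr hm))).trans (hgT m i)
  · -- eventually along `T n`, hence frequently in `τ`
    have h0 : (0 : ℝ≥0∞) < ENNReal.ofReal ε := ENNReal.ofReal_pos.mpr hε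
    exact hT.frequently ((hf.eventually (ge_mem_nhds h0)).and
      (eventually_all.mpr fun i ↦ (hgT i R').eventually (ge_mem_nhds h0))).frequently

/-! ### The recurrence clause of `Recurs k 𝒟` in sequential form -/

/-- **`Recurs k 𝒟`, sequential (diagonal) form.** A maximal development recurs at order `k` iff it
carries the SAME anchored, separating, exhaustive final-state-shaped late charts (clauses 1–10 of
`Recurs` verbatim: sub-extremal labels, late hole charts and a late flat chart into the
self-determined exterior `O`, sublinear tubes, exhaustion radii `Rᵢ → ∞`, the flat domain covering
the complement of the tubes, separation for every radius, `O = exteriorOf (charted)`, exhaustion of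
`O` at every chart time, the uniform `C⁰` anchor) together with a SEQUENCE of chart times `Tₙ → ∞`
along which the flat `Cᵏ` deviation and, for every hole `i` and every near-zone radius `R'`, the
truncated `Cᵏ` deviation from boosted Kerr tend to `0` — instead of "`∀ R' ∀ ε > 0 ∃ᶠ τ`"
(`frequently_le_iff_exists_seq_tendsto`, the truncated deviation being monotone in the radius,
`Spacetime.truncDeviationCk_mono`). This is the form in which every ω-limit / compactness argument
for the crux `OmegaLimitMultiKerr` delivers recurrence. [folklore] -/
theorem recurs_iff_exists_seq : ∀ {X : Type} [TopologicalSpace X] [ChartedSpace E3 X] [IsManifold (𝓡 3) ∞ X] [ConnectedSpace X] {D : InitialDataSet (𝓡 3) X} (k : ℕ) (𝒟 : VacuumCauchyDevelopment D), Recurs k 𝒟 ↔ ∃ (O : Set 𝒟.carrier) (N : ℕ) (M a : Fin N → ℝ) (mo : Fin N → lorentzGroup × E4) (τ₀ : ℝ) (Ψ : ∀ i, boostedKerrExterior (mo i).1 (mo i).2 (M i) (a i) → 𝒟.carrier) (ρ R : Fin N → ℝ → ℝ) (U₀ : Opens E4) (Ψ₀ : U₀ → 𝒟.carrier), (∀ i,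 Kerr.IsSubextremal (M i) (a i)) ∧ (∀ i, 𝒟.toSpacetime.IsLateChart (boostedKerrBackground (mo i).1 (mo i).2 (M i) (a i)) O τ₀ (Ψ i)) ∧ 𝒟.toSpacetime.IsLateChart (Minkowski.backgroundOn U₀) O τ₀ Ψ₀ ∧ (∀ i, Tendsto (fun t ↦ ρ i t / t) atTop (𝓝 0)) ∧ (∀ i, Tendsto (R i) atTop atTop) ∧ {x : E4 | τ₀ < x 0 ∧ ∀ i, ρ i (x 0) < Kerr.radius (a i) (poincareInv (mo i).1 (mo i).2 x)} ⊆ (U₀ : Set E4) ∧ (∀ R' : ℝ, ∃ τ₁ : ℝ, Pairwise (Function.onFun Disjoint fun i ↦ Ψ i '' (boostedKerrBackground (mo i).1 (mo i).2 (M i) (a i)).truncLateRegion τ₁ R')) ∧ O = Summit.FinalStateConjecture.exteriorOf 𝒟.toCauchyDevelopment ((⋃ i, Ψ i '' (boostedKerrBackground (mo i).1 (mo i).2 (M i) (a i)).lateRegion τ₀) ∪ Ψ₀ '' (Minkowski.backgroundOn U₀).lateRegion τ₀) ∧ (∀ τ₁ : ℝ, τ₀ < τ₁ → O \ (Ψ₀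 '' (Minkowski.backgroundOn U₀).lateRegion τ₁ ∪ ⋃ i, Ψ i '' {x | τ₁ < (boostedKerrBackground (mo i).1 (mo i).2 (M i) (a i)).time x.1 ∧ (boostedKerrBackground (mo i).1 (mo i).2 (M i) (a i)).radius x.1 ≤ R i ((boostedKerrBackground (mo i).1 (mo i).2 (M i) (a i)).time x.1)}) ⊆ 𝒟.metric.causalPast 𝒟.timeOrientation (Ψ₀ '' (Minkowski.backgroundOn U₀).timeSlab τ₁ ∪ ⋃ i, Ψ i '' (boostedKerrBackground (mo i).1 (mo i).2 (M i) (a i)).truncTimeSlab (R i τ₁) τ₁)) ∧ (∀ τ : ℝ, τ₀ < τ → 𝒟.toSpacetime.deviationCk (Minkowski.backgroundOn U₀) Ψ₀ 0 τ ≤ ENNReal.ofReal (1 / 4) ∧ ∀ i, 𝒟.toSpacetime.truncDeviationCk (boostedKerrBackground (mo i).1 (mo i).2 (M i) (a i)) (Ψ i) 0 (R i τ) τ ≤ ENNReal.ofReal (1 / 4)) ∧ ∃ T : ℕ → ℝ, Tendsto T atTop atTop ∧ Tendsto (fun n ↦ 𝒟.toSpacetime.deviationCk (Minkowski.backgroundOn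 U₀) Ψ₀ k (T n)) atTop (𝓝 0) ∧ ∀ i (R' : ℝ), Tendsto (fun n ↦ 𝒟.toSpacetime.truncDeviationCk (boostedKerrBackground (mo i).1 (mo i).2 (M i) (a i)) (Ψ i) k R' (T n)) atTop (𝓝 0) := by
  intro X _ _ _ _ D k 𝒟
  -- the two sides share the eleven binders and clauses 1–10; only the last clause changes
  refine exists_congr fun O ↦ exists_congr fun N ↦ exists_congr fun M ↦ exists_congr fun a ↦
    exists_congr fun mo ↦ exists_congr fun τ₀ ↦ exists_congr fun Ψ ↦ exists_congr fun ρ ↦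
    exists_congr fun R ↦ exists_congr fun U₀ ↦ exists_congr fun Ψ₀ ↦ ?_
  iterate 10 refine and_congr_right fun _ ↦ ?_
  exact frequently_le_iff_exists_seq_tendsto (ι := Fin N) fun i τ R₁ R₂ h ↦
    𝒟.toSpacetime.truncDeviationCk_mono (boostedKerrBackground (mo i).1 (mo i).2 (M i) (a i))
      (Ψ i) k h τ

end Summit.FinalStateConjecture.FinalStateConjecture.Theorems.ClusterCompleteness

end
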